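import Summits.HodgeConjecture.HodgeConjecture.Theses.VHCAbelianSchemesRoad

/-!
# Route VHCAbelianSchemesRoad (road b02, D-0059) — `Assembly` (assembly item stmt-HodgeConjecture-19539)

research route conditional on HC_CM; not a corollary; Q11.4-sentence-2 already refuted in dim ≥ 3.

The assembly item of route `VHCAbelianSchemesRoad` (rev 12; `closes` re-keyed to the diagonal slice at rev 14),

  ChernCharacterOnBetti → SemiregularSheafRepresentativesTwAt → TwistedPerfectDoor → RaynaudSectionProjective →
    AndreCMAnchoredPencil → AndreAnchoredPencilsAlgebraic →
    Summit.HodgeConjecture.HodgeConjecture.Theses.PadicSemiregularLift.HodgeAbelianVarieties,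

is the route's deciding theorem `VHCAbelianSchemesRoad.closes` curried (its hypotheses are exactly the route items
named in the item, in the same order).  Pure logic over the route file; no other import, no named-fact
hypothesis, no sorry; `HC_CM` occurs nowhere.  Nothing here says the crux K-SR♭∃
(`SemiregularSheafRepresentativesTwAt`), K-C, the twisted door, HC_AV or HC is proved: the theorem is the
IMPLICATION the item states.
-/

-- `Summit.HodgeConjecture.HodgeConjecture.Theorems` is the mandated namespace (single-problem summit:
-- Problem = Summit), which `linter.dupNamespace` flags; restated here so stand-alone elaboration is warning-free.
set_option linter.dupNamespace false

namespace Summit.HodgeConjecture.HodgeConjecture.Theorems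

/-- **Item stmt-HodgeConjecture-19539 (`Assembly`), route `VHCAbelianSchemesRoad`**: the route's six items
(K-C, the twin crux K-SR♭∃ over the twisted door, the twisted-perfect door by name, Raynaud's section
theorem by name, André's two compact-pencil facts by name) imply the leaf `HodgeAbelianVarieties` (HC_AV, rung
H1) — literally the deciding theorem `VHCAbelianSchemesRoad.closes`, curried.  The type is the route decl
`Summit.HodgeConjecture.HodgeConjecture.Theses.VHCAbelianSchemesRoad.Assembly`.
[cite: BuchweitzFlenner2003, §5 Thm. 5.1] [cite: Andre1996Motifs, §6.3 Lemmes 6.3.1–6.3.3] -/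
theorem vhcAbelianSchemesRoad_assembly_proof :
    Summit.HodgeConjecture.HodgeConjecture.Theses.VHCAbelianSchemesRoad.Assembly :=
  fun hC hTw hDoor hR h₂₁ h₂₂ ↦
    -- route rev 14 (2026-08-26T22:09Z) re-keyed the second binder of `closes` to the diagonal slice
    -- `SemiregularSheafRepresentativesTwAtDiag` (cells `(2m, m)`, `m ≥ 2`); the item's hypothesis
    -- `SemiregularSheafRepresentativesTwAt` implies it slice-wise (regime 2 at every `(n, p)`), so the
    -- curried deciding theorem still proves the UNCHANGED statement `Assembly`.
    -- route rev 21/22 (2026-08-27, R9.4–R9.8) re-keyed `closes` to the PRIMED binders; this proof no longer goes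
    -- through the text of `closes` but through the admissibility-generic kernel of `Theorems/VHCAbelianSchemesRoadDiagonal`
    -- at `AdmTw` (`bfSingleAdmissible` is its right disjunct), so it is stable under any future re-key of `closes`.
    Summit.HodgeConjecture.HodgeConjecture.Ring2.SemiregularRepresentatives.hc_av_of_exceptionalRegimeAt_twisted_diagonal_two hC
      (fun _ _ _ _ h => Or.inr h)
      (fun C m _ ↦
        Summit.HodgeConjecture.HodgeConjecture.Ring2.SemiregularRepresentatives.lefAtExceptionalRegimeAt_of_admissibleRepresentativesLefAtDeg
          ((Summit.HodgeConjecture.HodgeConjecture.Ring2.SemiregularRepresentatives.admissibleRepresentativesLefAt_iff_forall_deg).1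
            (hTw C) (2 * m) m))
      hDoor hR h₂₁ h₂₂

end Summit.HodgeConjecture.HodgeConjecture.Theorems
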